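/-
Copyright (c) 2026. All rights reserved.
Released under Apache 2.0 license as described in the file LICENSE.
-/
import Literature.NumberTheory.ComplexMultiplication.DegenerateCMTypesCyclicPrimeSquare
import Literature.NumberTheory.ComplexMultiplication.DegenerateCMTypesCyclicTwoOddPrimesCount
import HarnessLib

/-!
# The CM types of a cyclic group of order `2p²`, II: the COUNTS — `Σ_{i≤p} C(p,i)^p − 2` primitive degenerate
# types, `2^p` imprimitive ones, `2^{p²} + 2 − Σ_i C(p,i)^p − 2^p` nondegenerate; Dodson's weight-`3` orbits of `ℤ₉`

Sequel of `DegenerateCMTypesCyclicPrimeSquare` (same setting: a finite commutative group `G = ⟨ρ⟩ × ⟨σ⟩` of order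
`2p²`, `σ` of order `p²`, `ρ ∉ ⟨σ⟩`, `p` an odd prime; here moreover `ρ² = 1` — hypothesis `hρ2` — so that ALL
CM types for `ρ` can be enumerated; the two classes "`S ∈ S_p`" = `HasConstantRows p p S (σ^p) σ` (constant counts
on the `p` cosets of the subgroup of order `p`; the odd characters of order `2p` vanish) and "`S ∈ S₁`" =
`IsStableUnder S (σ^p)` (imprimitive; the faithful odd characters vanish), and the RANKS proved there:
`typeRank_eq_or_of_primitive`, `typeRank_mem`).  B. Dodson, *On the Mumford–Tate group of an abelian variety with
complex multiplication*, J. Algebra **111** (1987) [Dodson1987] (held text `paper:doi-10-1016-0021-8693-87-90242-0`,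
p0021–p0022), counts the types of the minimal group `⟨ρ⟩ × ℤ₉` by `ℤ₉`-orbits:

> PROPOSITION 4.4. "(1) Suppose `R₀ = ℤ₉` and weight(`f`) `= 3`. Then the orbits of order `9` give types with
> rank(`f`) `= 8` or `10`, and these orbits account for all but three `f`, in a single `ℤ₉`-orbit. […] *Proof.*
> (1) There are two distinct Hol(`ℤ₉`)-orbits of `ℤ₉`-orbits of order `9`, with respective ranks `8` and `10`. We
> note here that three orbits of order `9` consist of types for which rank(`f`) `= 8`."
> (Prop. 4.1, proof: "the orbit of `f` under `R₀` is of order `9`" unless weight(`f`) `∈ {0, 3, 6, 9}`.)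

The counting mechanism is F. Hazama's Prop. 4.1 [Hazama2003CyclicCM] ("the correspondence `S → E(S)` gives a
bijection between the set of CM-types for `ℤ/2nℤ` and the set of `{±1}`-valued function on `ℤ/nℤ`"), in the form
of the tree's `DegenerateCMTypesCyclicTwoOddPrimesCount`: a CM type `S` corresponds to its row function
`r = rowSet p p S (σ^p) σ : ℤ/p → 𝒫(ℤ/p)` (`r(y) = {x : σ^{px+y} ∈ S}`), inverse `typeOfRows p p ρ (σ^p) σ` — the
generic DEFINITIONS and the generic counting lemmas `card_filter_rows_*` of that file are REUSED with `q = p`,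
`τ = σ^p`, `κ = σ`; only the frame lemmas are re-proved here for `⟨ρ⟩ × ℤ_{p²}`.

## What is PROVED (theorems only; no definition, no named fact, no `sorry`)

* §1 `pow_pow_mul_pow_mem_typeOfRows_iff`, `rho_mul_mem_typeOfRows_iff`, **`isCMTypeWith_typeOfRows`**,
  `rowSet_typeOfRows`, `typeOfRows_rowSet` (CM types `↔` row functions), the transport
  **`ncard_cmTypes_sep_eq_card_filter`**, **`ncard_cmTypes`** (`2^{p²}` CM types; Dodson's `f ∈ ℤ₂⁹`).
* §2 `isStableUnder_iff_rowSet` (`σ^p S = S` iff every row is `∅` or full).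
* §3 THE COUNTS: **`ncard_hasConstantRows`** (`#S_p = Σ_{i≤p} C(p,i)^p`), **`ncard_isStableUnder`**
  (`#S₁ = 2^p`), `ncard_isStableUnder_and_hasConstantRows` (`2`: `S_even`, `S_odd`),
  **`ncard_primitive_hasConstantRows`** = **`ncard_primitive_degenerate`** (the primitive degenerate types number
  `Σ_{i≤p} C(p,i)^p − 2`, all of rank `(p−1)p + 2`), `ncard_primitive` (`2^{p²} − 2^p`), `ncard_degenerate`
  (`#Deg + 2 = Σ_i C(p,i)^p + 2^p`), **`ncard_nondegenerate`** (`#Nondeg + Σ_i C(p,i)^p + 2^p = 2^{p²} + 2`),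
  **`ncard_typeRank_eq`** (by value: `#{rank 2} = 2`, `#{rank p+1} = 2^p − 2`, `#{rank (p−1)p+2} = Σ_i C(p,i)^p − 2`).
* §4 Dodson's weight-`p` orbits (weight = number of points of `S` in the odd part `⟨σ⟩` =
  `#{(x,y) : σ^{px+y} ∈ S}`): `card_rowSet_eq_one_of_hasConstantRows`,
  **`typeRank_eq_of_hasConstantRows_of_weight_eq`** (weight `p` with constant cosets ⟹ primitive of rank
  `(p−1)p + 2`), **`ncard_hasConstantRows_and_weight_eq`** (`p^p` such types: "three orbits of order `9` consist
  of types for which rank(`f`) `= 8`", `27 = 3·9`), **`ncard_isStableUnder_and_weight_eq`** (`p` imprimitive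
  types of weight `p`: "all but three `f`, in a single `ℤ₉`-orbit").
* §5 `p = 3` (`σ` of order `9`, `|G| = 18`): **`counts_three`** — `512` types; `56` with constant cosets, `8`
  imprimitive, `2` both; **`54` primitive degenerate (rank `8`)**, `504` primitive, **`450` of rank `10`**, `6` of
  rank `4`, `2` of rank `2`; weight `3`: `27` of rank `8` with constant cosets, `3` imprimitive.

NOT here: the Hol(`ℤ₉`)-orbit structure of Lemma 4.2 ("two distinct Hol(`ℤ₉`)-orbits … with respective ranks `8`
and `10`"), Prop. 4.4 (2) (`R₀ = ℤ₃²`), the number-field dress (sequel).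

## References

* [Dodson1987] B. Dodson, J. Algebra 111 (1987) 49–73: §4.1 Prop. 4.1 (proof), Prop. 4.4 (1) with proof (p. 70),
  Remark 4.7.
* [Hazama2003CyclicCM] F. Hazama, J. Math. Sci. Univ. Tokyo 10 (2003) 581–598: Prop. 4.1, Prop. 4.3, Prop. 4.5,
  Prop. 4.7.
* [Kubota1965] T. Kubota, Trans. AMS 118 (1965), §4 Lemma 2.

## Provenance

Lane `lit-hodgefound` (Track 2, Layer A3 — CM types), seat `lit-hodgefound-p10` generation 35, row g35-#2; neighbours
cited by name, nothing restated: `DegenerateCMTypesCyclicPrimeSquare` (g35-#1), `DegenerateCMTypesCyclicTwoOddPrimesCount`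
(`rowSet`, `typeOfRows`, `mem_rowSet_iff`, `hasConstantRows_iff_rowSet`, `card_filter_rows_card_eq`,
`card_filter_rows_card_const`, `card_filter_rows_trivial`, `card_filter_rows_const_and_trivial`).
-/

set_option autoImplicit false

noncomputable section

open scoped BigOperators

namespace Literature.NumberTheory.ComplexMultiplication

namespace CyclicCMType

namespace PrimeSq

variable {G : Type*} [CommGroup G] [Fintype G] [DecidableEq G] {p : ℕ} [hp : Fact p.Prime] {ρ σ : G}

/-! ## §1 CM types of `⟨ρ⟩ × ℤ_{p²}` ↔ row functions `r : ℤ/p → 𝒫(ℤ/p)` (Prop. 4.1 for the `p²`-frame) -/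

section Matrix

omit [Fintype G] [DecidableEq G] hp in
/-- `(σ^p)ˣ σʸ = σ^{px + y}`. [folklore] -/
private theorem pow_pow_mul_pow (x y : ℕ) : (σ ^ p) ^ x * σ ^ y = σ ^ (p * x + y) := by
  rw [← pow_mul, ← pow_add]

omit [Fintype G] [DecidableEq G] hp in
/-- In `⟨ρ⟩ × ⟨σ⟩` no element `ρσ^{px+y}` is an element `σ^{px'+y'}` (`ρ ∉ ⟨σ⟩`). [folklore] -/
private theorem rho_mul_ne (hρσ : ρ ∉ Subgroup.zpowers σ) (x y x' y' : ℕ) :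
    ρ * ((σ ^ p) ^ x * σ ^ y) ≠ (σ ^ p) ^ x' * σ ^ y' := by
  rw [pow_pow_mul_pow, pow_pow_mul_pow]
  intro h
  apply hρσ
  have : ρ = σ ^ (p * x' + y') * (σ ^ (p * x + y))⁻¹ := by rw [← h, mul_inv_cancel_right]
  rw [this]
  exact mul_mem (pow_mem (Subgroup.mem_zpowers σ) _) (inv_mem (pow_mem (Subgroup.mem_zpowers σ) _))

omit [Fintype G] in
/-- `σ^{px+y} ∈ S(r) ↔ x ∈ r(y)` for the type `S(r)` with prescribed rows (the tree's `typeOfRows`, here on the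
`p²`-frame `τ = σ^p`, `κ = σ`). [cite: Hazama2003CyclicCM, Prop. 4.1] [cite: Dodson1987, §4.1] -/
theorem pow_pow_mul_pow_mem_typeOfRows_iff (hσ : orderOf σ = p ^ 2) (hρσ : ρ ∉ Subgroup.zpowers σ)
    (r : ZMod p → Finset (ZMod p)) (x y : ZMod p) :
    (σ ^ p) ^ x.val * σ ^ y.val ∈ typeOfRows p p ρ (σ ^ p) σ r ↔ x ∈ r y := by
  unfold typeOfRows
  rw [Finset.mem_image]
  constructor
  · rintro ⟨⟨x', y'⟩, -, h⟩
    dsimp only at h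
    split_ifs at h with hc
    · obtain ⟨rfl, rfl⟩ := Prod.mk.inj (pow_pow_mul_pow_injective hσ h)
      exact hc
    · exact absurd h (rho_mul_ne hρσ _ _ _ _)
  · intro hx
    exact ⟨(x, y), Finset.mem_univ _, by simp [hx]⟩

omit [Fintype G] in
/-- `ρσ^{px+y} ∈ S(r) ↔ x ∉ r(y)`. [cite: Hazama2003CyclicCM, Prop. 4.1] [cite: Dodson1987, §4.1] -/
theorem rho_mul_mem_typeOfRows_iff (hσ : orderOf σ = p ^ 2) (hρσ : ρ ∉ Subgroup.zpowers σ)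
    (r : ZMod p → Finset (ZMod p)) (x y : ZMod p) :
    ρ * ((σ ^ p) ^ x.val * σ ^ y.val) ∈ typeOfRows p p ρ (σ ^ p) σ r ↔ x ∉ r y := by
  unfold typeOfRows
  rw [Finset.mem_image]
  constructor
  · rintro ⟨⟨x', y'⟩, -, h⟩
    dsimp only at h
    split_ifs at h with hc
    · exact absurd h.symm (rho_mul_ne hρσ _ _ _ _)
    · obtain ⟨rfl, rfl⟩ := Prod.mk.inj (pow_pow_mul_pow_injective hσ (mul_left_cancel h))
      exact hc
  · intro hx
    exact ⟨(x, y), Finset.mem_univ _, by simp [hx]⟩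

/-- **`S(r)` is a CM type for `ρ`** on `⟨ρ⟩ × ℤ_{p²}` (`ρ² = 1`; every element is `σ^{px+y}` or `ρσ^{px+y}`
and exactly one of the two lies in `S(r)`): Dodson's "`f ∈ ℤ₂⁹` defines a type on `⟨ρ⟩ × R₀`".
[cite: Dodson1987, Prop. 4.1] [cite: Hazama2003CyclicCM, Prop. 4.1] -/
theorem isCMTypeWith_typeOfRows (hρ2 : ρ * ρ = 1) (hσ : orderOf σ = p ^ 2) (hρσ : ρ ∉ Subgroup.zpowers σ)
    (hcard : Fintype.card G = 2 * p ^ 2) (r : ZMod p → Finset (ZMod p)) :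
    IsCMTypeWith ρ (typeOfRows p p ρ (σ ^ p) σ r : Set G) := by
  refine ⟨fun g => ?_, fun g x => ?_, fun x => ?_⟩
  · obtain ⟨⟨x, y⟩, rfl | rfl⟩ := exists_coord hσ hρσ hcard g
    · rw [Finset.mem_coe, smul_eq_mul, Finset.mem_coe, pow_pow_mul_pow_mem_typeOfRows_iff hσ hρσ,
        rho_mul_mem_typeOfRows_iff hσ hρσ, not_not]
    · rw [Finset.mem_coe, smul_eq_mul, Finset.mem_coe,
        show ρ * (ρ * ((σ ^ p) ^ x.val * σ ^ y.val)) = (σ ^ p) ^ x.val * σ ^ y.val by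
          rw [← mul_assoc, hρ2, one_mul],
        pow_pow_mul_pow_mem_typeOfRows_iff hσ hρσ, rho_mul_mem_typeOfRows_iff hσ hρσ]
  · change g * (ρ * x) = ρ * (g * x)
    rw [mul_left_comm]
  · change ρ * (ρ * x) = x
    rw [← mul_assoc, hρ2, one_mul]

omit [Fintype G] in
/-- The rows of `S(r)` are `r`. [cite: Hazama2003CyclicCM, Prop. 4.1] -/
theorem rowSet_typeOfRows (hσ : orderOf σ = p ^ 2) (hρσ : ρ ∉ Subgroup.zpowers σ)
    (r : ZMod p → Finset (ZMod p)) : rowSet p p (typeOfRows p p ρ (σ ^ p) σ r) (σ ^ p) σ = r := by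
  funext y
  ext x
  rw [mem_rowSet_iff, pow_pow_mul_pow_mem_typeOfRows_iff hσ hρσ]

/-- A CM type of `⟨ρ⟩ × ℤ_{p²}` is the type of its rows (Dodson: types `↔ f ∈ ℤ₂^{p²}`; Hazama: `S ↦ E(S)` is
injective). [cite: Dodson1987, Prop. 4.1] [cite: Hazama2003CyclicCM, Prop. 4.1] -/
theorem typeOfRows_rowSet (hσ : orderOf σ = p ^ 2) (hρσ : ρ ∉ Subgroup.zpowers σ)
    (hcard : Fintype.card G = 2 * p ^ 2) {Φ : Finset G} (h : IsCMTypeWith ρ (Φ : Set G)) :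
    typeOfRows p p ρ (σ ^ p) σ (rowSet p p Φ (σ ^ p) σ) = Φ := by
  ext g
  obtain ⟨⟨x, y⟩, rfl | rfl⟩ := exists_coord hσ hρσ hcard g
  · rw [pow_pow_mul_pow_mem_typeOfRows_iff hσ hρσ, mem_rowSet_iff]
  · rw [rho_mul_mem_typeOfRows_iff hσ hρσ, mem_rowSet_iff, rho_mul_mem_iff h]

/-- Counting a set cut out of a finite type by a predicate. [folklore] -/
private theorem ncard_setOf_eq_card_filter' {α : Type*} [Fintype α] (P : α → Prop) [DecidablePred P] :
    {a : α | P a}.ncard = (Finset.univ.filter P).card := by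
  rw [← Set.ncard_coe_finset]
  congr 1
  ext a
  simp

/-- **Transport of counts along `S ↦ rows(S)`** (`ρ² = 1`): for predicates `P` on types and `Q` on row
functions that agree, `#{S CM type : P(S)} = #{r : Q(r)}` — Dodson's identification of the types on
`⟨ρ⟩ × R₀` with `f ∈ ℤ₂^{p²}`. [cite: Dodson1987, Prop. 4.1] [cite: Hazama2003CyclicCM, Prop. 4.1] -/
theorem ncard_cmTypes_sep_eq_card_filter (hρ2 : ρ * ρ = 1) (hσ : orderOf σ = p ^ 2)
    (hρσ : ρ ∉ Subgroup.zpowers σ) (hcard : Fintype.card G = 2 * p ^ 2) (P : Finset G → Prop)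
    (Q : (ZMod p → Finset (ZMod p)) → Prop) [DecidablePred Q]
    (hPQ : ∀ Φ : Finset G, IsCMTypeWith ρ (Φ : Set G) → (P Φ ↔ Q (rowSet p p Φ (σ ^ p) σ))) :
    {Φ : Finset G | IsCMTypeWith ρ (Φ : Set G) ∧ P Φ}.ncard = (Finset.univ.filter Q).card := by
  classical
  rw [ncard_setOf_eq_card_filter']
  refine Finset.card_bij (fun Φ _ => rowSet p p Φ (σ ^ p) σ) (fun Φ hΦ => ?_) (fun Φ₁ h₁ Φ₂ h₂ h => ?_)
    (fun r hr => ?_)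
  · rw [Finset.mem_filter] at hΦ ⊢
    exact ⟨Finset.mem_univ _, (hPQ Φ hΦ.2.1).1 hΦ.2.2⟩
  · rw [Finset.mem_filter] at h₁ h₂
    rw [← typeOfRows_rowSet hσ hρσ hcard h₁.2.1, ← typeOfRows_rowSet hσ hρσ hcard h₂.2.1, h]
  · rw [Finset.mem_filter] at hr
    refine ⟨typeOfRows p p ρ (σ ^ p) σ r, ?_, rowSet_typeOfRows hσ hρσ r⟩
    rw [Finset.mem_filter]
    refine ⟨Finset.mem_univ _, isCMTypeWith_typeOfRows hρ2 hσ hρσ hcard r, ?_⟩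
    rw [hPQ _ (isCMTypeWith_typeOfRows hρ2 hσ hρσ hcard r), rowSet_typeOfRows hσ hρσ]
    exact hr.2

/-- **There are `2^{p²}` CM types for `ρ`** on the group of order `2p²` (Dodson's `f ∈ ℤ₂⁹`: `512` for `p = 3`).
[cite: Dodson1987, Prop. 4.1] -/
theorem ncard_cmTypes (hρ2 : ρ * ρ = 1) (hσ : orderOf σ = p ^ 2) (hρσ : ρ ∉ Subgroup.zpowers σ)
    (hcard : Fintype.card G = 2 * p ^ 2) :
    {Φ : Finset G | IsCMTypeWith ρ (Φ : Set G)}.ncard = 2 ^ (p ^ 2) := by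
  classical
  have h := ncard_cmTypes_sep_eq_card_filter hρ2 hσ hρσ hcard (fun _ => True) (fun _ => True)
    fun _ _ => Iff.rfl
  simp only [and_true, Finset.filter_true_of_mem (fun _ _ => trivial), Finset.card_univ, Fintype.card_fun,
    Fintype.card_finset, ZMod.card] at h
  rw [h, ← pow_mul, sq]

end Matrix

/-! ## §2 The two classes read on the rows -/

section Dictionary

variable {Φ : Finset G}

/-- A subset of `ℤ/p` all of whose points are simultaneously in or out is `∅` or everything. [folklore] -/
private theorem eq_empty_or_univ_iff (A : Finset (ZMod p)) :
    (A = ∅ ∨ A = Finset.univ) ↔ ∀ x x' : ZMod p, (x ∈ A ↔ x' ∈ A) := by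
  constructor
  · rintro (rfl | rfl) x x' <;> simp
  · intro H
    by_cases h0 : (0 : ZMod p) ∈ A
    · exact Or.inr (Finset.eq_univ_iff_forall.2 fun x => (H x 0).2 h0)
    · exact Or.inl (Finset.eq_empty_iff_forall_notMem.2 fun x hx => h0 ((H x 0).1 hx))

/-- **`σ^p S = S` iff every row of `S` is `∅` or all of `ℤ/p`** (each coset `σʸ⟨σ^p⟩` lies in `S` entirely or
not at all: Dodson's "the coordinates of `f` are constant on the orbits of the subgroup").
[cite: Dodson1987, Prop. 4.1 (proof)] [cite: Hazama2003CyclicCM, Prop. 4.7] -/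
theorem isStableUnder_iff_rowSet (hσ : orderOf σ = p ^ 2) (hρσ : ρ ∉ Subgroup.zpowers σ)
    (hcard : Fintype.card G = 2 * p ^ 2) (h : IsCMTypeWith ρ (Φ : Set G)) :
    IsStableUnder Φ (σ ^ p) ↔
      ∀ y : ZMod p, rowSet p p Φ (σ ^ p) σ y = ∅ ∨ rowSet p p Φ (σ ^ p) σ y = Finset.univ := by
  rw [← forall_signMatrix_eq_iff_isStableUnder hσ hρσ hcard h]
  simp only [signMatrix, typeSign_eq_typeSign_iff, eq_empty_or_univ_iff, mem_rowSet_iff]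
  exact ⟨fun H y x x' => H x x' y, fun H x x' y => H y x x'⟩

/-- Rows all `∅`/full with constant size ⟺ constant rows all `∅`/full (`∅ ≠ ℤ/p` in size). [folklore] -/
private theorem trivial_and_card_const_iff (r : ZMod p → Finset (ZMod p)) :
    ((∀ y, r y = ∅ ∨ r y = Finset.univ) ∧ ∀ y y', (r y).card = (r y').card) ↔
      ((∀ y y', r y = r y') ∧ ∀ y, r y = ∅ ∨ r y = Finset.univ) := by
  constructor
  · rintro ⟨H, Hc⟩
    refine ⟨fun y y' => ?_, H⟩
    rcases H y with hy | hy <;> rcases H y' with hy' | hy'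
    · rw [hy, hy']
    · exfalso
      have := Hc y y'
      rw [hy, hy', Finset.card_empty, Finset.card_univ, ZMod.card] at this
      exact hp.out.ne_zero this.symm
    · exfalso
      have := Hc y y'
      rw [hy, hy', Finset.card_empty, Finset.card_univ, ZMod.card] at this
      exact hp.out.ne_zero this
    · rw [hy, hy']
  · rintro ⟨H, H'⟩
    exact ⟨H', fun y y' => by rw [H y y']⟩

end Dictionary

/-! ## §3 The counts -/

section Counts

variable {Φ : Finset G}

/-- **`#S_p = Σ_{0≤i≤p} C(p,i)^p`**: the CM types meeting the `p` cosets of the subgroup of order `p` in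
constant numbers (the class on which the odd characters of order `2p` vanish,
`sum_char_eq_zero_iff_hasConstantRows`) — Hazama's Prop. 4.3 count with `q = p`; `56` for `p = 3`.
[cite: Hazama2003CyclicCM, Prop. 4.3] [cite: Dodson1987, Prop. 4.4 (1)] -/
theorem ncard_hasConstantRows (hρ2 : ρ * ρ = 1) (hσ : orderOf σ = p ^ 2) (hρσ : ρ ∉ Subgroup.zpowers σ)
    (hcard : Fintype.card G = 2 * p ^ 2) :
    {Φ : Finset G | IsCMTypeWith ρ (Φ : Set G) ∧ HasConstantRows p p Φ (σ ^ p) σ}.ncard =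
      ∑ i ∈ Finset.range (p + 1), p.choose i ^ p := by
  classical
  rw [← card_filter_rows_card_const p p]
  exact ncard_cmTypes_sep_eq_card_filter hρ2 hσ hρσ hcard _ _ fun Φ _ => hasConstantRows_iff_rowSet

/-- **`#S₁ = 2^p`: the IMPRIMITIVE types** (`σ^p S = S`, i.e. induced from the quotient of order `2p`;
Dodson's `ℤ₉`-orbits of order `3` together with `{0, ρ}`: `8` types for `p = 3`).
[cite: Dodson1987, Prop. 4.4 (1)] [cite: Hazama2003CyclicCM, Prop. 4.7] -/
theorem ncard_isStableUnder (hρ2 : ρ * ρ = 1) (hσ : orderOf σ = p ^ 2) (hρσ : ρ ∉ Subgroup.zpowers σ)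
    (hcard : Fintype.card G = 2 * p ^ 2) :
    {Φ : Finset G | IsCMTypeWith ρ (Φ : Set G) ∧ IsStableUnder Φ (σ ^ p)}.ncard = 2 ^ p := by
  classical
  rw [← card_filter_rows_trivial p p]
  exact ncard_cmTypes_sep_eq_card_filter hρ2 hσ hρσ hcard _ _ fun Φ h => isStableUnder_iff_rowSet hσ hρσ hcard h

/-- **`#(S₁ ∩ S_p) = 2`**: `S_even = ⟨σ⟩`-part in, `S_odd` = `⟨σ⟩`-part out (Dodson's orbit `{0, ρ}`).
[cite: Hazama2003CyclicCM, Prop. 4.5] [cite: Dodson1987, Prop. 4.4 (1)] -/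
theorem ncard_isStableUnder_and_hasConstantRows (hρ2 : ρ * ρ = 1) (hσ : orderOf σ = p ^ 2)
    (hρσ : ρ ∉ Subgroup.zpowers σ) (hcard : Fintype.card G = 2 * p ^ 2) :
    {Φ : Finset G | IsCMTypeWith ρ (Φ : Set G) ∧
        (IsStableUnder Φ (σ ^ p) ∧ HasConstantRows p p Φ (σ ^ p) σ)}.ncard = 2 := by
  classical
  rw [← card_filter_rows_const_and_trivial p p]
  refine ncard_cmTypes_sep_eq_card_filter hρ2 hσ hρσ hcard _ _ fun Φ h => ?_
  rw [isStableUnder_iff_rowSet hσ hρσ hcard h, hasConstantRows_iff_rowSet, trivial_and_card_const_iff]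

/-- **The PRIMITIVE DEGENERATE types number `Σ_{0≤i≤p} C(p,i)^p − 2`** (`= #(S_p − S₁)`: primitive with
constant coset counts, all of rank `(p−1)p + 2` by `typeRank_eq_of_primitive_of_hasConstantRows`): `54` for
`p = 3` — Dodson's "three orbits of order `9` [of weight `3`] consist of types for which rank(`f`) `= 8`" and
their `ρ`-translates (weight `6`), `27 + 27`. [cite: Dodson1987, Prop. 4.4 (1)] -/
theorem ncard_primitive_hasConstantRows (hp2 : p ≠ 2) (hρ2 : ρ * ρ = 1) (hσ : orderOf σ = p ^ 2)
    (hρσ : ρ ∉ Subgroup.zpowers σ) (hcard : Fintype.card G = 2 * p ^ 2) :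
    {Φ : Finset G | IsCMTypeWith ρ (Φ : Set G) ∧
        (HasConstantRows p p Φ (σ ^ p) σ ∧ ∀ u : G, u ≠ 1 → ¬ IsStableUnder Φ u)}.ncard =
      ∑ i ∈ Finset.range (p + 1), p.choose i ^ p - 2 := by
  classical
  have hsplit := Finset.card_filter_add_card_filter_not
    (s := Finset.univ.filter fun r : ZMod p → Finset (ZMod p) => ∀ y y', (r y).card = (r y').card)
    (fun r : ZMod p → Finset (ZMod p) => ∀ y, r y = ∅ ∨ r y = Finset.univ)
  rw [Finset.filter_filter, Finset.filter_filter, card_filter_rows_card_const] at hsplit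
  have h1 : (Finset.univ.filter fun r : ZMod p → Finset (ZMod p) =>
      (∀ y y', (r y).card = (r y').card) ∧ ∀ y, r y = ∅ ∨ r y = Finset.univ).card = 2 := by
    rw [← card_filter_rows_const_and_trivial p p]
    congr 1
    exact Finset.filter_congr fun r _ => by rw [and_comm, trivial_and_card_const_iff]
  rw [h1] at hsplit
  have h2 : {Φ : Finset G | IsCMTypeWith ρ (Φ : Set G) ∧
      (HasConstantRows p p Φ (σ ^ p) σ ∧ ∀ u : G, u ≠ 1 → ¬ IsStableUnder Φ u)}.ncard =
      (Finset.univ.filter fun r : ZMod p → Finset (ZMod p) => (∀ y y', (r y).card = (r y').card) ∧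
        ¬ ∀ y, r y = ∅ ∨ r y = Finset.univ).card := by
    refine ncard_cmTypes_sep_eq_card_filter hρ2 hσ hρσ hcard _ _ fun Φ h => ?_
    rw [hasConstantRows_iff_rowSet, ← isStableUnder_iff_rowSet hσ hρσ hcard h,
      forall_not_isStableUnder_iff hp2 hσ hρσ hcard h]
  rw [h2]
  omega

/-- **The primitive degenerate types, counted by rank**: `#{S primitive : rank(S) ≠ p² + 1} = Σ_i C(p,i)^p − 2`.
[cite: Dodson1987, Prop. 4.4 (1)] -/
theorem ncard_primitive_degenerate (hp2 : p ≠ 2) (hρ2 : ρ * ρ = 1) (hσ : orderOf σ = p ^ 2)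
    (hρσ : ρ ∉ Subgroup.zpowers σ) (hcard : Fintype.card G = 2 * p ^ 2) :
    {Φ : Finset G | IsCMTypeWith ρ (Φ : Set G) ∧
        ((∀ u : G, u ≠ 1 → ¬ IsStableUnder Φ u) ∧ typeRank G (Φ : Set G) ≠ p ^ 2 + 1)}.ncard =
      ∑ i ∈ Finset.range (p + 1), p.choose i ^ p - 2 := by
  refine Eq.trans ?_ (ncard_primitive_hasConstantRows hp2 hρ2 hσ hρσ hcard)
  congr 1
  ext Φ
  simp only [Set.mem_setOf_eq]
  refine ⟨fun ⟨h, hprim, hne⟩ => ⟨h, ?_, hprim⟩, fun ⟨h, hr, hprim⟩ => ⟨h, hprim, ?_⟩⟩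
  · exact (typeRank_ne_iff_of_primitive hp2 hσ hρσ hcard h hprim).1 hne
  · exact (typeRank_ne_iff_of_primitive hp2 hσ hρσ hcard h hprim).2 hr

/-- **`#{S : S primitive} = 2^{p²} − 2^p`** (Dodson's `ℤ₉`-orbits of order `9`: `504 = 56 · 9` types for
`p = 3`). [cite: Dodson1987, Prop. 4.1 (proof)] -/
theorem ncard_primitive (hp2 : p ≠ 2) (hρ2 : ρ * ρ = 1) (hσ : orderOf σ = p ^ 2)
    (hρσ : ρ ∉ Subgroup.zpowers σ) (hcard : Fintype.card G = 2 * p ^ 2) :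
    {Φ : Finset G | IsCMTypeWith ρ (Φ : Set G) ∧ ∀ u : G, u ≠ 1 → ¬ IsStableUnder Φ u}.ncard =
      2 ^ (p ^ 2) - 2 ^ p := by
  classical
  have hsplit := Finset.card_filter_add_card_filter_not
    (s := (Finset.univ : Finset (ZMod p → Finset (ZMod p))))
    (fun r : ZMod p → Finset (ZMod p) => ∀ y, r y = ∅ ∨ r y = Finset.univ)
  rw [card_filter_rows_trivial, Finset.card_univ, Fintype.card_fun, Fintype.card_finset, ZMod.card,
    ← pow_mul, ← sq] at hsplit
  have h2 : {Φ : Finset G | IsCMTypeWith ρ (Φ : Set G) ∧ ∀ u : G, u ≠ 1 → ¬ IsStableUnder Φ u}.ncard =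
      (Finset.univ.filter fun r : ZMod p → Finset (ZMod p) => ¬ ∀ y, r y = ∅ ∨ r y = Finset.univ).card := by
    refine ncard_cmTypes_sep_eq_card_filter hρ2 hσ hρσ hcard _ _ fun Φ h => ?_
    rw [← isStableUnder_iff_rowSet hσ hρσ hcard h, forall_not_isStableUnder_iff hp2 hσ hρσ hcard h]
  rw [h2]
  omega

/-- **`#Deg = Σ_{i≤p} C(p,i)^p + 2^p − 2`** (degenerate = `S_p ∪ S₁`, `#(S_p ∩ S₁) = 2`).
[cite: Dodson1987, Prop. 4.4 (1)] [cite: Kubota1965, §4 Lemma 2] -/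
theorem ncard_degenerate (hp2 : p ≠ 2) (hρ2 : ρ * ρ = 1) (hσ : orderOf σ = p ^ 2)
    (hρσ : ρ ∉ Subgroup.zpowers σ) (hcard : Fintype.card G = 2 * p ^ 2) :
    {Φ : Finset G | IsCMTypeWith ρ (Φ : Set G) ∧ typeRank G (Φ : Set G) ≠ p ^ 2 + 1}.ncard + 2 =
      ∑ i ∈ Finset.range (p + 1), p.choose i ^ p + 2 ^ p := by
  classical
  let R : (ZMod p → Finset (ZMod p)) → Prop := fun r => ∀ y y', (r y).card = (r y').card
  let T : (ZMod p → Finset (ZMod p)) → Prop := fun r => ∀ y, r y = ∅ ∨ r y = Finset.univ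
  have hR : (Finset.univ.filter R).card = ∑ i ∈ Finset.range (p + 1), p.choose i ^ p :=
    card_filter_rows_card_const p p
  have hT : (Finset.univ.filter T).card = 2 ^ p := card_filter_rows_trivial p p
  have hRT : (Finset.univ.filter fun r => R r ∧ T r).card = 2 := by
    rw [← card_filter_rows_const_and_trivial p p]
    congr 1
    exact Finset.filter_congr fun r _ => by
      change ((∀ y y', (r y).card = (r y').card) ∧ ∀ y, r y = ∅ ∨ r y = Finset.univ) ↔ _
      rw [and_comm, trivial_and_card_const_iff]
  have hdeg : {Φ : Finset G | IsCMTypeWith ρ (Φ : Set G) ∧ typeRank G (Φ : Set G) ≠ p ^ 2 + 1}.ncard =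
      (Finset.univ.filter fun r => R r ∨ T r).card := by
    refine ncard_cmTypes_sep_eq_card_filter hρ2 hσ hρσ hcard _ _ fun Φ h => ?_
    rw [typeRank_ne_iff hp2 hσ hρσ hcard h, isStableUnder_iff_rowSet hσ hρσ hcard h]
    rfl
  have hie := Finset.card_union_add_card_inter (Finset.univ.filter R) (Finset.univ.filter T)
  rw [← Finset.filter_or, ← Finset.filter_and, hR, hT, hRT] at hie
  rw [hdeg]
  exact hie

/-- `Σ_{i≤p} C(p,i)^p ≥ 2` (the terms `i = 0` and `i = p`). [folklore] -/
private theorem two_le_sum_choose_pow : 2 ≤ ∑ i ∈ Finset.range (p + 1), p.choose i ^ p := by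
  have hp1 : 1 ≤ p := hp.out.one_lt.le
  have h0 : p.choose 0 ^ p = 1 := by rw [Nat.choose_zero_right, one_pow]
  have hpp : p.choose p ^ p = 1 := by rw [Nat.choose_self, one_pow]
  have hsub : ({0, p} : Finset ℕ) ⊆ Finset.range (p + 1) := by
    intro i hi
    simp only [Finset.mem_insert, Finset.mem_singleton] at hi
    rcases hi with rfl | rfl <;> simp
  calc 2 = ∑ i ∈ ({0, p} : Finset ℕ), p.choose i ^ p := by
        rw [Finset.sum_pair (by omega : (0 : ℕ) ≠ p), h0, hpp]
    _ ≤ ∑ i ∈ Finset.range (p + 1), p.choose i ^ p := Finset.sum_le_sum_of_subset hsub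

/-- **The NONDEGENERATE types number `2^{p²} + 2 − Σ_{i≤p} C(p,i)^p − 2^p`** (`450` for `p = 3`: Dodson's
types of rank `10`). [cite: Dodson1987, Prop. 4.4 (1) and Prop. 4.1] -/
theorem ncard_nondegenerate (hp2 : p ≠ 2) (hρ2 : ρ * ρ = 1) (hσ : orderOf σ = p ^ 2)
    (hρσ : ρ ∉ Subgroup.zpowers σ) (hcard : Fintype.card G = 2 * p ^ 2) :
    {Φ : Finset G | IsCMTypeWith ρ (Φ : Set G) ∧ typeRank G (Φ : Set G) = p ^ 2 + 1}.ncard +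
        ∑ i ∈ Finset.range (p + 1), p.choose i ^ p + 2 ^ p = 2 ^ (p ^ 2) + 2 := by
  classical
  have hdeg := ncard_degenerate hp2 hρ2 hσ hρσ hcard
  have htot := ncard_cmTypes hρ2 hσ hρσ hcard
  -- split all CM types into nondegenerate and degenerate
  have hsplit : {Φ : Finset G | IsCMTypeWith ρ (Φ : Set G) ∧ typeRank G (Φ : Set G) = p ^ 2 + 1}.ncard +
      {Φ : Finset G | IsCMTypeWith ρ (Φ : Set G) ∧ typeRank G (Φ : Set G) ≠ p ^ 2 + 1}.ncard =
      {Φ : Finset G | IsCMTypeWith ρ (Φ : Set G)}.ncard := by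
    rw [← Set.ncard_union_eq (Set.disjoint_left.2 fun Φ h1 h2 => h2.2 h1.2) (Set.toFinite _)
      (Set.toFinite _)]
    congr 1
    ext Φ
    simp only [Set.mem_union, Set.mem_setOf_eq]
    tauto
  rw [htot] at hsplit
  omega

/-- **Counting by rank value**: `#{rank = 2} = 2`, `#{rank = p + 1} = 2^p − 2`,
`#{rank = (p−1)p + 2} = Σ_{i≤p} C(p,i)^p − 2` (all primitive), the rest have rank `p² + 1`.
[cite: Dodson1987, Prop. 4.4 (1)] [cite: Kubota1965, §4 Lemma 2] -/
theorem ncard_typeRank_eq (hp2 : p ≠ 2) (hρ2 : ρ * ρ = 1) (hσ : orderOf σ = p ^ 2)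
    (hρσ : ρ ∉ Subgroup.zpowers σ) (hcard : Fintype.card G = 2 * p ^ 2) :
    {Φ : Finset G | IsCMTypeWith ρ (Φ : Set G) ∧ typeRank G (Φ : Set G) = 2}.ncard = 2 ∧
    {Φ : Finset G | IsCMTypeWith ρ (Φ : Set G) ∧ typeRank G (Φ : Set G) = p + 1}.ncard = 2 ^ p - 2 ∧
    {Φ : Finset G | IsCMTypeWith ρ (Φ : Set G) ∧ typeRank G (Φ : Set G) = (p - 1) * p + 2}.ncard =
      ∑ i ∈ Finset.range (p + 1), p.choose i ^ p - 2 := by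
  classical
  have hp1 : 1 < p := hp.out.one_lt
  have hp3 : 3 ≤ p := by
    rcases Nat.lt_or_ge p 3 with h | h
    · interval_cases p
      exact absurd rfl hp2
    · exact h
  -- the four rank values are pairwise distinct
  have hne1 : (p - 1) * p + 2 ≠ p + 1 := by
    intro e
    have : (p - 1) * p + 1 = p := by omega
    have h2 : 2 * p ≤ (p - 1) * p := Nat.mul_le_mul_right p (by omega)
    omega
  have hne2 : (p - 1) * p + 2 ≠ 2 := by
    intro e
    have : (p - 1) * p = 0 := by omega
    rcases Nat.mul_eq_zero.1 this with h | h <;> omega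
  have hne3 : p + 1 ≠ 2 := by omega
  -- the classes behind each value
  have key : ∀ Φ : Finset G, IsCMTypeWith ρ (Φ : Set G) →
      ((typeRank G (Φ : Set G) = 2 ↔ IsStableUnder Φ (σ ^ p) ∧ HasConstantRows p p Φ (σ ^ p) σ) ∧
      (typeRank G (Φ : Set G) = p + 1 ↔ IsStableUnder Φ (σ ^ p) ∧ ¬ HasConstantRows p p Φ (σ ^ p) σ) ∧
      (typeRank G (Φ : Set G) = (p - 1) * p + 2 ↔
        HasConstantRows p p Φ (σ ^ p) σ ∧ ∀ u : G, u ≠ 1 → ¬ IsStableUnder Φ u)) := by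
    intro Φ h
    have hprim := forall_not_isStableUnder_iff hp2 hσ hρσ hcard h
    by_cases hs : IsStableUnder Φ (σ ^ p)
    · by_cases hr : HasConstantRows p p Φ (σ ^ p) σ
      · have e := typeRank_eq_two_of_isStableUnder_of_hasConstantRows hp2 hσ hρσ hcard h hs hr
        rw [e]
        refine ⟨iff_of_true rfl ⟨hs, hr⟩, iff_of_false hne3.symm fun h' => h'.2 hr,
          iff_of_false hne2.symm fun h' => (hprim.1 h'.2) hs⟩
      · have e := typeRank_eq_of_isStableUnder_of_not_hasConstantRows hp2 hσ hρσ hcard h hs hr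
        rw [e]
        refine ⟨iff_of_false hne3 fun h' => hr h'.2, iff_of_true rfl ⟨hs, hr⟩,
          iff_of_false (Ne.symm hne1) fun h' => hr h'.1⟩
    · have hprim' := hprim.2 hs
      by_cases hr : HasConstantRows p p Φ (σ ^ p) σ
      · have e := typeRank_eq_of_primitive_of_hasConstantRows hp2 hσ hρσ hcard h hprim' hr
        rw [e]
        refine ⟨iff_of_false hne2 fun h' => hs h'.1, iff_of_false hne1 fun h' => hs h'.1,
          iff_of_true rfl ⟨hr, hprim'⟩⟩
      · have e := typeRank_eq_of_primitive_of_not_hasConstantRows hp2 hσ hρσ hcard h hprim' hr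
        rw [e]
        have hbig : p ^ 2 + 1 ≠ (p - 1) * p + 2 := by
          intro e'
          have : (p - 1) * p + (p - 1) = p ^ 2 - 1 := by
            zify [hp1.le, Nat.one_le_pow 2 p hp.out.pos]
            ring
          have hpp : p ≤ p ^ 2 := by rw [sq]; exact Nat.le_mul_self p
          omega
        have hpp : p < p ^ 2 := by rw [sq]; exact lt_mul_self hp1
        refine ⟨iff_of_false (by omega) fun h' => hs h'.1, iff_of_false (by omega) fun h' => hs h'.1,
          iff_of_false hbig fun h' => hr h'.1⟩
  refine ⟨?_, ?_, ?_⟩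
  · refine Eq.trans ?_ (ncard_isStableUnder_and_hasConstantRows hρ2 hσ hρσ hcard)
    congr 1
    ext Φ
    simp only [Set.mem_setOf_eq]
    exact ⟨fun ⟨h, e⟩ => ⟨h, ((key Φ h).1).1 e⟩, fun ⟨h, hc⟩ => ⟨h, ((key Φ h).1).2 hc⟩⟩
  · have hs := ncard_isStableUnder hρ2 hσ hρσ hcard
    have hsr := ncard_isStableUnder_and_hasConstantRows hρ2 hσ hρσ hcard
    have hsplit : {Φ : Finset G | IsCMTypeWith ρ (Φ : Set G) ∧
        (IsStableUnder Φ (σ ^ p) ∧ HasConstantRows p p Φ (σ ^ p) σ)}.ncard +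
        {Φ : Finset G | IsCMTypeWith ρ (Φ : Set G) ∧
          (IsStableUnder Φ (σ ^ p) ∧ ¬ HasConstantRows p p Φ (σ ^ p) σ)}.ncard =
        {Φ : Finset G | IsCMTypeWith ρ (Φ : Set G) ∧ IsStableUnder Φ (σ ^ p)}.ncard := by
      rw [← Set.ncard_union_eq (Set.disjoint_left.2 fun Φ h1 h2 => h2.2.2 h1.2.2) (Set.toFinite _)
        (Set.toFinite _)]
      congr 1
      ext Φ
      simp only [Set.mem_union, Set.mem_setOf_eq]
      tauto
    rw [hs, hsr] at hsplit
    have e : {Φ : Finset G | IsCMTypeWith ρ (Φ : Set G) ∧ typeRank G (Φ : Set G) = p + 1} =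
        {Φ : Finset G | IsCMTypeWith ρ (Φ : Set G) ∧
          (IsStableUnder Φ (σ ^ p) ∧ ¬ HasConstantRows p p Φ (σ ^ p) σ)} := by
      ext Φ
      simp only [Set.mem_setOf_eq]
      exact ⟨fun ⟨h, e⟩ => ⟨h, ((key Φ h).2.1).1 e⟩, fun ⟨h, hc⟩ => ⟨h, ((key Φ h).2.1).2 hc⟩⟩
    rw [e]
    omega
  · refine Eq.trans ?_ (ncard_primitive_hasConstantRows hp2 hρ2 hσ hρσ hcard)
    congr 1
    ext Φ
    simp only [Set.mem_setOf_eq]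
    exact ⟨fun ⟨h, e⟩ => ⟨h, ((key Φ h).2.2).1 e⟩, fun ⟨h, hc⟩ => ⟨h, ((key Φ h).2.2).2 hc⟩⟩

end Counts

/-! ## §4 Dodson's weight-`p` orbits: "three orbits of order 9 … all but three `f`, in a single `ℤ₉`-orbit" -/

section Weight

variable {Φ : Finset G}

omit [Fintype G] in
/-- The number of points of `S` in the odd part `⟨σ⟩` (Dodson's weight of `f`, up to `f ↦ f + ρ`) is the sum
of the row sizes. [cite: Dodson1987, §4.1 ("weight(`f`) is the number of nonzero coordinates of `f`")] -/
theorem card_filter_mem_eq_sum_card_rowSet :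
    (Finset.univ.filter fun xy : ZMod p × ZMod p => (σ ^ p) ^ xy.1.val * σ ^ xy.2.val ∈ Φ).card =
      ∑ y : ZMod p, (rowSet p p Φ (σ ^ p) σ y).card := by
  rw [← sum_rowCount_eq p p Φ (σ ^ p) σ]
  rfl

/-- Row functions with constant row size and total size `p` are exactly those with all rows of size `1`.
[folklore] -/
private theorem card_const_and_sum_eq_iff (r : ZMod p → Finset (ZMod p)) :
    ((∀ y y', (r y).card = (r y').card) ∧ ∑ y : ZMod p, (r y).card = p) ↔ ∀ y, (r y).card = 1 := by
  constructor
  · rintro ⟨H, hs⟩ y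
    rw [Finset.sum_congr rfl fun y' _ => H y' y, Finset.sum_const, Finset.card_univ, ZMod.card,
      smul_eq_mul] at hs
    have hp0 := hp.out.pos
    exact Nat.eq_of_mul_eq_mul_left hp0 (hs.trans (mul_one p).symm)
  · intro H
    refine ⟨fun y y' => by rw [H y, H y'], ?_⟩
    rw [Finset.sum_congr rfl fun y _ => H y, Finset.sum_const, Finset.card_univ, ZMod.card, smul_eq_mul,
      mul_one]

omit [Fintype G] in
/-- **A type of weight `p` with constant coset counts has exactly one point in each coset** (Dodson's weight-`3`
types of rank `8`: one nonzero coordinate in each coset of `ℤ₃`). [cite: Dodson1987, Prop. 4.4 (1)] -/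
theorem card_rowSet_eq_one_of_hasConstantRows (hr : HasConstantRows p p Φ (σ ^ p) σ)
    (hw : (Finset.univ.filter fun xy : ZMod p × ZMod p => (σ ^ p) ^ xy.1.val * σ ^ xy.2.val ∈ Φ).card = p)
    (y : ZMod p) : (rowSet p p Φ (σ ^ p) σ y).card = 1 := by
  rw [card_filter_mem_eq_sum_card_rowSet] at hw
  exact (card_const_and_sum_eq_iff _).1 ⟨hasConstantRows_iff_rowSet.1 hr, hw⟩ y

/-- **Such a type is PRIMITIVE** (a row with one point is neither empty nor a full coset, so `σ^p S ≠ S`) and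
hence has rank `(p − 1)p + 2` — Dodson's "orbits of order `9`" of weight `3` "for which rank(`f`) `= 8`".
[cite: Dodson1987, Prop. 4.4 (1)] -/
theorem typeRank_eq_of_hasConstantRows_of_weight_eq (hp2 : p ≠ 2) (hσ : orderOf σ = p ^ 2)
    (hρσ : ρ ∉ Subgroup.zpowers σ) (hcard : Fintype.card G = 2 * p ^ 2) (h : IsCMTypeWith ρ (Φ : Set G))
    (hr : HasConstantRows p p Φ (σ ^ p) σ)
    (hw : (Finset.univ.filter fun xy : ZMod p × ZMod p => (σ ^ p) ^ xy.1.val * σ ^ xy.2.val ∈ Φ).card = p) :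
    (∀ u : G, u ≠ 1 → ¬ IsStableUnder Φ u) ∧ typeRank G (Φ : Set G) = (p - 1) * p + 2 := by
  have h1 := card_rowSet_eq_one_of_hasConstantRows hr hw
  have hp1 : 1 < p := hp.out.one_lt
  have hns : ¬ IsStableUnder Φ (σ ^ p) := by
    rw [isStableUnder_iff_rowSet hσ hρσ hcard h]
    intro H
    rcases H 0 with h0 | h0
    · have := h1 0; rw [h0, Finset.card_empty] at this; exact zero_ne_one this
    · have := h1 0; rw [h0, Finset.card_univ, ZMod.card] at this; exact hp1.ne' this
  have hprim := (forall_not_isStableUnder_iff hp2 hσ hρσ hcard h).2 hns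
  exact ⟨hprim, typeRank_eq_of_primitive_of_hasConstantRows hp2 hσ hρσ hcard h hprim hr⟩

/-- **"Three orbits of order `9` consist of types for which rank(`f`) `= 8`"**: the types of weight `p` with
constant coset counts number `p^p` (`= C(p,1)^p`: one point chosen in each of the `p` cosets; `27 = 3 · 9` for
`p = 3`), every one primitive of rank `(p−1)p + 2`. [cite: Dodson1987, Prop. 4.4 (1) (proof)] -/
theorem ncard_hasConstantRows_and_weight_eq (hρ2 : ρ * ρ = 1) (hσ : orderOf σ = p ^ 2)
    (hρσ : ρ ∉ Subgroup.zpowers σ) (hcard : Fintype.card G = 2 * p ^ 2) :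
    {Φ : Finset G | IsCMTypeWith ρ (Φ : Set G) ∧ (HasConstantRows p p Φ (σ ^ p) σ ∧
        (Finset.univ.filter fun xy : ZMod p × ZMod p => (σ ^ p) ^ xy.1.val * σ ^ xy.2.val ∈ Φ).card = p)}.ncard
      = p ^ p := by
  classical
  have hc := card_filter_rows_card_eq p p 1
  rw [Nat.choose_one_right] at hc
  refine Eq.trans (ncard_cmTypes_sep_eq_card_filter hρ2 hσ hρσ hcard _ _ fun Φ _ => ?_) hc
  rw [card_filter_mem_eq_sum_card_rowSet, hasConstantRows_iff_rowSet, card_const_and_sum_eq_iff]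

/-- Row functions with every row `∅` or full and total size `p` are exactly the "one full row" functions.
[folklore] -/
private theorem trivial_and_sum_eq_iff (r : ZMod p → Finset (ZMod p)) :
    ((∀ y, r y = ∅ ∨ r y = Finset.univ) ∧ ∑ y : ZMod p, (r y).card = p) ↔
      ∃ y₀ : ZMod p, r = fun y => if y = y₀ then Finset.univ else ∅ := by
  classical
  have hp0 := hp.out.pos
  constructor
  · rintro ⟨H, hs⟩
    -- the total size is `p · #{y : r y = univ}`
    have hsum : ∑ y : ZMod p, (r y).card =
        p * (Finset.univ.filter fun y : ZMod p => r y = Finset.univ).card := by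
      rw [Finset.card_filter, Finset.mul_sum]
      refine Finset.sum_congr rfl fun y _ => ?_
      rcases H y with hy | hy
      · rw [hy, Finset.card_empty, if_neg, mul_zero]
        intro he
        have := congrArg Finset.card he
        rw [Finset.card_empty, Finset.card_univ, ZMod.card] at this
        exact hp0.ne this
      · rw [hy, if_pos rfl, Finset.card_univ, ZMod.card, mul_one]
    rw [hsum] at hs
    have hone := Nat.eq_of_mul_eq_mul_left hp0 (hs.trans (mul_one p).symm)
    obtain ⟨y₀, hy₀⟩ := Finset.card_eq_one.1 hone
    refine ⟨y₀, funext fun y => ?_⟩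
    have hmem : ∀ y, r y = Finset.univ ↔ y = y₀ := fun y => by
      have := Finset.ext_iff.1 hy₀ y
      simpa only [Finset.mem_filter, Finset.mem_univ, true_and, Finset.mem_singleton] using this
    by_cases hy : y = y₀
    · rw [if_pos hy]; exact (hmem y).2 hy
    · rw [if_neg hy]
      rcases H y with h' | h'
      · exact h'
      · exact absurd ((hmem y).1 h') hy
  · rintro ⟨y₀, rfl⟩
    refine ⟨fun y => ?_, ?_⟩
    · by_cases hy : y = y₀
      · exact Or.inr (by simp [hy])
      · exact Or.inl (by simp [hy])
    · rw [Finset.sum_eq_single y₀]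
      · simp
      · intro y _ hy; simp [hy]
      · intro h'; exact absurd (Finset.mem_univ _) h'

/-- **"These orbits account for all but three `f`, in a single `ℤ₉`-orbit"**: the IMPRIMITIVE types of weight
`p` (`σ^p S = S` with `p` points in `⟨σ⟩`: exactly one full coset) number `p`. [cite: Dodson1987, Prop. 4.4 (1)] -/
theorem ncard_isStableUnder_and_weight_eq (hρ2 : ρ * ρ = 1) (hσ : orderOf σ = p ^ 2)
    (hρσ : ρ ∉ Subgroup.zpowers σ) (hcard : Fintype.card G = 2 * p ^ 2) :
    {Φ : Finset G | IsCMTypeWith ρ (Φ : Set G) ∧ (IsStableUnder Φ (σ ^ p) ∧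
        (Finset.univ.filter fun xy : ZMod p × ZMod p => (σ ^ p) ^ xy.1.val * σ ^ xy.2.val ∈ Φ).card = p)}.ncard
      = p := by
  classical
  have hcount : (Finset.univ.filter fun r : ZMod p → Finset (ZMod p) =>
      ∃ y₀ : ZMod p, r = fun y => if y = y₀ then Finset.univ else ∅).card = p := by
    have he : (Finset.univ.filter fun r : ZMod p → Finset (ZMod p) =>
        ∃ y₀ : ZMod p, r = fun y => if y = y₀ then Finset.univ else ∅) =
        (Finset.univ : Finset (ZMod p)).image fun y₀ => fun y => if y = y₀ then Finset.univ else ∅ := by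
      ext r
      simp only [Finset.mem_filter, Finset.mem_univ, true_and, Finset.mem_image]
      exact ⟨fun ⟨y₀, h⟩ => ⟨y₀, h.symm⟩, fun ⟨y₀, h⟩ => ⟨y₀, h.symm⟩⟩
    rw [he, Finset.card_image_of_injective, Finset.card_univ, ZMod.card]
    intro y₁ y₂ h
    by_contra hne
    have h1 := congrFun h y₁
    simp only [if_true, hne, if_false] at h1
    have hc := congrArg Finset.card h1
    rw [Finset.card_univ, ZMod.card, Finset.card_empty] at hc
    exact hp.out.ne_zero hc
  refine Eq.trans (ncard_cmTypes_sep_eq_card_filter hρ2 hσ hρσ hcard _ _ fun Φ h => ?_) hcount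
  rw [card_filter_mem_eq_sum_card_rowSet, isStableUnder_iff_rowSet hσ hρσ hcard h, trivial_and_sum_eq_iff]

end Weight

/-! ## §5 The numbers for `p = 3` (`⟨ρ⟩ × ℤ₉`: the cyclic CM fields of degree `18`, e.g. `ℚ(ζ₁₉)`, `ℚ(ζ₂₇)`) -/

section Three

variable {ρ σ : G} {Φ : Finset G}

/-- `Σ_{i≤3} C(3,i)³ = 56`. [cite: Dodson1987, Prop. 4.4 (1)] -/
theorem sum_choose_pow_three : ∑ i ∈ Finset.range (3 + 1), (3 : ℕ).choose i ^ 3 = 56 := by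
  decide

/-- **The census of the `512` CM types of the cyclic group of order `18`** (Dodson's `f ∈ ℤ₂⁹` on `⟨ρ⟩ × ℤ₉`):
`56` with constant coset counts, `8` imprimitive (`ℤ₉`-orbits of order `3` and `{0, ρ}`), `2` both; **`54`
PRIMITIVE DEGENERATE types, all of rank `8`** (six `ℤ₉`-orbits of order `9`: Dodson's "three orbits" of weight `3`
and their `ρ`-translates of weight `6`), `504` primitive types in all, **`450` nondegenerate (rank `10`)**, `6` of
rank `4`, `2` of rank `2`; weight `3`: `27` types of rank `8` with constant cosets and `3` imprimitive ones.
[cite: Dodson1987, Prop. 4.4 (1) and Remark 4.7] -/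
theorem counts_three (hρ2 : ρ * ρ = 1) (hσ : orderOf σ = 9) (hρσ : ρ ∉ Subgroup.zpowers σ)
    (hcard : Fintype.card G = 18) :
    {Φ : Finset G | IsCMTypeWith ρ (Φ : Set G)}.ncard = 512 ∧
    {Φ : Finset G | IsCMTypeWith ρ (Φ : Set G) ∧ HasConstantRows 3 3 Φ (σ ^ 3) σ}.ncard = 56 ∧
    {Φ : Finset G | IsCMTypeWith ρ (Φ : Set G) ∧ IsStableUnder Φ (σ ^ 3)}.ncard = 8 ∧
    {Φ : Finset G | IsCMTypeWith ρ (Φ : Set G) ∧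
        (IsStableUnder Φ (σ ^ 3) ∧ HasConstantRows 3 3 Φ (σ ^ 3) σ)}.ncard = 2 ∧
    {Φ : Finset G | IsCMTypeWith ρ (Φ : Set G) ∧
        ((∀ u : G, u ≠ 1 → ¬ IsStableUnder Φ u) ∧ typeRank G (Φ : Set G) ≠ 10)}.ncard = 54 ∧
    {Φ : Finset G | IsCMTypeWith ρ (Φ : Set G) ∧ ∀ u : G, u ≠ 1 → ¬ IsStableUnder Φ u}.ncard = 504 ∧
    {Φ : Finset G | IsCMTypeWith ρ (Φ : Set G) ∧ typeRank G (Φ : Set G) = 10}.ncard = 450 ∧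
    {Φ : Finset G | IsCMTypeWith ρ (Φ : Set G) ∧ typeRank G (Φ : Set G) = 8}.ncard = 54 ∧
    {Φ : Finset G | IsCMTypeWith ρ (Φ : Set G) ∧ typeRank G (Φ : Set G) = 4}.ncard = 6 ∧
    {Φ : Finset G | IsCMTypeWith ρ (Φ : Set G) ∧ typeRank G (Φ : Set G) = 2}.ncard = 2 ∧
    {Φ : Finset G | IsCMTypeWith ρ (Φ : Set G) ∧ (HasConstantRows 3 3 Φ (σ ^ 3) σ ∧
        (Finset.univ.filter fun xy : ZMod 3 × ZMod 3 => (σ ^ 3) ^ xy.1.val * σ ^ xy.2.val ∈ Φ).card = 3)}.ncard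
      = 27 ∧
    {Φ : Finset G | IsCMTypeWith ρ (Φ : Set G) ∧ (IsStableUnder Φ (σ ^ 3) ∧
        (Finset.univ.filter fun xy : ZMod 3 × ZMod 3 => (σ ^ 3) ^ xy.1.val * σ ^ xy.2.val ∈ Φ).card = 3)}.ncard
      = 3 := by
  haveI : Fact (Nat.Prime 3) := ⟨Nat.prime_three⟩
  have hσ' : orderOf σ = 3 ^ 2 := by rw [hσ]; norm_num
  have hcard' : Fintype.card G = 2 * 3 ^ 2 := by rw [hcard]; norm_num
  have h32 : (3 : ℕ) ≠ 2 := by norm_num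
  have hrank := ncard_typeRank_eq h32 hρ2 hσ' hρσ hcard'
  rw [sum_choose_pow_three] at hrank
  norm_num at hrank
  refine ⟨?_, ?_, ?_, ?_, ?_, ?_, ?_, hrank.2.2, hrank.2.1, hrank.1, ?_, ?_⟩
  · rw [ncard_cmTypes hρ2 hσ' hρσ hcard']; norm_num
  · rw [ncard_hasConstantRows hρ2 hσ' hρσ hcard', sum_choose_pow_three]
  · rw [ncard_isStableUnder hρ2 hσ' hρσ hcard']; norm_num
  · rw [ncard_isStableUnder_and_hasConstantRows hρ2 hσ' hρσ hcard']
  · have h := ncard_primitive_degenerate h32 hρ2 hσ' hρσ hcard'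
    rw [sum_choose_pow_three] at h
    norm_num at h
    exact h
  · rw [ncard_primitive h32 hρ2 hσ' hρσ hcard']; norm_num
  · have h := ncard_nondegenerate h32 hρ2 hσ' hρσ hcard'
    rw [sum_choose_pow_three] at h
    norm_num at h
    omega
  · rw [ncard_hasConstantRows_and_weight_eq hρ2 hσ' hρσ hcard']; norm_num
  · rw [ncard_isStableUnder_and_weight_eq hρ2 hσ' hρσ hcard']

end Three

end PrimeSq

end CyclicCMType

end Literature.NumberTheory.ComplexMultiplication

end
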